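/-
Copyright (c) 2026. All rights reserved.
Released under Apache 2.0 license as described in the file LICENSE.
Authors: abc-iut cell, statement-typer seat abc-iut-L4-t9 (wave 2, block W2-B2).
-/
import Literature.AnabelianGeometry.AbsoluteAnabelian.DiagramMorphisms
import Literature.AnabelianGeometry.AbsoluteAnabelian.AbsTopIII.MonoAnabelianComparisonMLF
import Literature.AnabelianGeometry.AbsoluteAnabelian.AbsTopIII.MonoAnabelianComparisonShapes

/-!
# [AbsTopIII] Corollary 3.7 (i), (v): the diagrams of categories `𝒟† ⊆ 𝒟‡ ⊆ 𝒟*`, the two cores,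
# the nexus `□` (proved), total `□`-rigidity and the `ℤ`-action

S. Mochizuki, *Topics in absolute anabelian geometry III: global reconstruction algorithms*,
J. Math. Sci. Univ. Tokyo 22 (2015) 939–1156 [MochizukiAbsTopIII2015]; locators = pages of the
author's manuscript (`paper:url-5493eb38cbb7`, 164 pp.; journal pagination not held), read on the
page: Cor 3.7 pp. 86–88; Def 3.5 (iii)–(vi) pp. 75–77 (observables, cores, rigidity, nexus).

The INPUT is `𝔖 : BiAnabelianSetting X E N` (`MonoAnabelianComparisonMLF.lean`: rows ≤ 4 of the
diagram `𝒟` of Cor 3.6 with `T = T𝔽`, abstract); the categories are placed on the oriented graph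
`Cor37Vertex`/`Cor37Edge` of `MonoAnabelianComparisonShapes.lean` using abc-iut-L4-t2's Def 3.5
formalism (`DiagramOfCategories`, `Observable`, `Observable.IsCore`, `IsNexus`,
`IsTotallyNexusRigid`, `SelfEquivalence.IsNexusClass`). Universe convention = t2's: all
categories `Type u` with `Category.{u}` (then `𝒳 ×_𝔈 𝒳 : Type u`).

* `BiAnabelianSetting.starDiagram` = the diagram of categories `𝒟*` of Cor 3.7 (ii) p. 87 (row 1:
  copies of `𝒳 ×_𝔈 𝒳` joined by `log_𝒳 = log ×_𝔈 𝒳`; `pr_⋎`; `λ^×, λ^{×pf}`; `𝒩 → 𝔈`; the appended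
  core vertex `𝒳` with `π_⋎` into it and the telecore edges `δ_⋎ = δ_𝒳` out of it; `δ_□ = id_𝒳`).
  `𝒟†_{≤n}` (`daggerLe n`), `𝒟† = 𝒟†_{≤4}`, `𝒟*_{≤n}` (`starLe n`) are its full sub-diagrams
  (t2's `restrict`); `𝒟‡_δ` = `starLe 1` (row 1 with the core: edges `log_𝒳, π_⋎, δ_⋎`).
  Relation to t2's Cor 3.6 input: `𝒟†` is t2's `LogFrobeniusData.diagram` restricted to rows ≤ 4
  with `X₁ := 𝒳 ×_𝔈 𝒳`, `toNexus := pr` (the generalisation t2 built in for this purpose); we do not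
  instantiate `LogFrobeniusData` itself because its rows 5–6 (`Anab`, `κ_An`, `φ_An`, `η_An`) are
  exactly the mono-anabelian data Cor 3.7 does without (Rmk 3.7.1).
* Cor 3.7 (i), typed like abc-iut-L4-t5's `CoreStmt4` for Cor 3.6 (i) (the observation SHAPE is
  pinned — the single printed edge `𝒩 → 𝔈`, resp. the projections `π_⋎` — and only the family of
  homotopies is quantified; an unpinned "∃ observable with observation category `𝔈`" would be
  satisfiable by constant functors): `GaloisCoreStmt` ("`𝔈` forms a core of the functors in `𝒟†`":
  `𝒟†_{≤4}` is a core on `𝒟†_{≤3}`), `RefCoreStmt` ("the second factor `𝒳` forms a core of the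
  functors in `𝒟‡_{≤1}`": `𝒟‡_{≤1}` is a core on `𝒟†_{≤1}`), `Cor_3_7_i` = both. Per-setting
  `Prop`s (FACT-policy; for the genuine setting they hold by "the proofs of Cor 3.6", p. 88).
* Cor 3.7 (v): "The vertex `□` of the second row of `𝒟*` is a nexus of `Γ⃗_{𝒟*}`" is PROVED
  (`box_isNexus`, from the edge analysis `Cor37Edge.box_nexus`); "`𝒟*` is totally `□`-rigid"
  (`TotallyBoxRigidStmt`) and "the natural action of `ℤ` on `Γ⃗_{𝒟†_{≤1}}` extends to an action of
  `ℤ` on `𝒟*` by nexus-classes of self-equivalences" (`ShiftStmt`, the underlying graph maps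
  pinned to `Cor37Vertex.shift m`, with the action law up to 2-isomorphism as in t5's Cor 3.6 (v))
  are per-setting `Prop`s. NOT typed (docstring only, as for t5's Cor 3.6 (v)): the closing
  sentence "the self-equivalences in these nexus-classes are compatible with `ℋ_δ` [and] with the
  families of homotopies that constitute the cores, telecore, and observable of (i), (ii), (iii)"
  (needs transport of families of homotopies along morphisms of graphs, not in the Def 3.5 files).
* Cor 3.7 (ii) [telecore `𝔗_δ`, family `ℋ_δ`, `𝒟*` a core on `𝒟*_{≤3}`], (iii) [observable
  `𝔖†_log`], (iv) [the two incompatibilities]: sibling file `BiAnabelianIncompatibility.lean`.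

Refereed pre-IUT anabelian geometry; nothing here bears on [IUTchIII] Cor. 3.12; typed ≠ discharged
except `box_isNexus`.
-/

set_option autoImplicit false

namespace Literature.AnabelianGeometry.AbsoluteAnabelian.AbsTopIII

open CategoryTheory Quiver DiagramOfCategories

universe u

/-! ## Cor 3.7 (v), first sentence: `□` is a nexus of `Γ⃗_{𝒟*}` (proved) -/

namespace Cor37Vertex

/-- **Cor 3.7 (v), first sentence**: "The vertex `□` of the second row of `𝒟*` is a nexus of
`Γ⃗_{𝒟*}`" — with pre-nexus portion `Γ⃗_{<□}` = row 1 (the copies of `𝒳 ×_𝔈 𝒳` and the core vertex)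
and post-nexus portion rows 3–4, in the sense of §0 p. 27 as typed by abc-iut-L4-t2 (`IsNexus`).
PROVED from the edge analysis `Cor37Edge.box_nexus`. [cite: MochizukiAbsTopIII2015, Cor 3.7 (v) p.88] -/
theorem box_isNexus : IsNexus (Cor37Vertex.box : Cor37Vertex) {a : Cor37Vertex | a.BelowBox} where
  not_mem := by simp [BelowBox, row]
  pre_nonempty := ⟨first 0, rfl⟩
  post_nonempty := ⟨space, by decide, by simp [BelowBox, row]⟩
  no_edge_across a b ha hb hb' := by
    simp only [Set.mem_setOf_eq] at ha hb
    refine ⟨⟨fun e => ?_⟩, ⟨fun e => ?_⟩⟩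
    · rcases Cor37Edge.box_nexus e with h | h | h | h
      · exact hb h.2
      · exact absurd ha (by have := h.1; simp_all [BelowBox, AboveBox])
      · exact hb' h.2
      · exact absurd ha (by rw [h.1]; simp [BelowBox, row])
    · rcases Cor37Edge.box_nexus e with h | h | h | h
      · exact hb h.1
      · exact absurd ha (by have := h.2; simp_all [BelowBox, AboveBox])
      · exact absurd ha (by rw [h.2]; simp [BelowBox, row])
      · exact hb' h.1
  edge_in a := by
    rintro ⟨e⟩
    rcases Cor37Edge.box_nexus e with h | h | h | h
    · exact absurd h.2 (by simp [BelowBox, row])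
    · exact absurd h.2 (by simp [AboveBox, row])
    · exact h.1
    · exact absurd h.2 (by simp [AboveBox, row])
  edge_out b := by
    rintro ⟨e⟩
    rcases Cor37Edge.box_nexus e with h | h | h | h
    · exact absurd h.1 (by simp [BelowBox, row])
    · exact absurd h.1 (by simp [AboveBox, row])
    · exact absurd h.1 (by simp [BelowBox, row])
    · refine ⟨?_, ?_⟩
      · have := h.2; simp_all [BelowBox, AboveBox]; omega
      · rintro rfl; exact absurd h.2 (by simp [AboveBox, row])

/-- A first-row vertex lies in `𝒟†_{≤n}` for `n ≥ 1`. [cite: MochizukiAbsTopIII2015, Cor 3.7 p.86] -/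
theorem first_inDaggerLe (m : ℤ) {n : ℕ} (h : 1 ≤ n) : (first m).InDaggerLe n :=
  ⟨by simp [InDagger], by simpa [row] using h⟩

/-- `□` lies in `𝒟†_{≤n}` for `n ≥ 2`. [cite: MochizukiAbsTopIII2015, Cor 3.7 p.86] -/
theorem box_inDaggerLe {n : ℕ} (h : 2 ≤ n) : box.InDaggerLe n :=
  ⟨by simp [InDagger], by simpa [row] using h⟩

/-- The `𝒩`-vertex lies in `𝒟†_{≤n}` for `n ≥ 3`. [cite: MochizukiAbsTopIII2015, Cor 3.7 p.86] -/
theorem space_inDaggerLe {n : ℕ} (h : 3 ≤ n) : space.InDaggerLe n :=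
  ⟨by simp [InDagger], by simpa [row] using h⟩

end Cor37Vertex

namespace BiAnabelianSetting

variable {X E N : Type u} [Category.{u} X] [Category.{u} E] [Category.{u} N]
  (𝔖 : BiAnabelianSetting X E N)

/-! ## The diagram of categories `𝒟*` and its sub-diagrams `𝒟†_{≤n}`, `𝒟*_{≤n}` -/

/-- The category at each vertex of `𝒟*`: `𝒳 ×_𝔈 𝒳` on the first row, `𝒳` at `□`, `𝒩`, `𝔈`, and
`𝒳` ("the second factor", the "universal reference model") at the appended core vertex.
[cite: MochizukiAbsTopIII2015, Cor 3.7 (ii) p.87] -/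
def objAt : Cor37Vertex → Type u
  | .first _ => 𝔖.Sq
  | .box => X
  | .space => N
  | .galois => E
  | .ref => X

/-- The category structure at each vertex of `𝒟*`. [cite: MochizukiAbsTopIII2015, Cor 3.7 (ii) p.87] -/
instance catAt : (a : Cor37Vertex) → Category.{u} (𝔖.objAt a)
  | .first _ => inferInstanceAs (Category 𝔖.Sq)
  | .box => inferInstanceAs (Category X)
  | .space => inferInstanceAs (Category N)
  | .galois => inferInstanceAs (Category E)
  | .ref => inferInstanceAs (Category X)

/-- The functor on each edge of `𝒟*`: `log_𝒳 = log ×_𝔈 𝒳` on the first row, `pr_⋎`, `λ^×`,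
`λ^{×pf}`, `𝒩 → 𝔈`, `π_⋎`, the telecore edges `δ_⋎ = δ_𝒳`, and `δ_□` "given by a copy of the
identity functor". [cite: MochizukiAbsTopIII2015, Cor 3.7 (ii) p.87] -/
def mapAt : ∀ {a b : Cor37Vertex}, Cor37Edge.{u} a b → (𝔖.objAt a ⥤ 𝔖.objAt b)
  | _, _, .log _ _ _ => 𝔖.logSq
  | _, _, .pr _ => 𝔖.pr
  | _, _, .lamTimes => 𝔖.lamTimes
  | _, _, .lamTimesPf => 𝔖.lamTimesPf
  | _, _, .toGal => 𝔖.spaceGal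
  | _, _, .proj _ => 𝔖.proj
  | _, _, .diag _ => 𝔖.diag
  | _, _, .diagBox => 𝟭 X

/-- **The diagram of categories `𝒟*`** of Cor 3.7 (ii) ("obtained by gluing `𝒟‡_δ` to `𝒟‡` along
`𝒟‡_{≤1}` and then appending an edge `δ_□`"), on the oriented graph `Γ⃗_{𝒟*}` (`Cor37Vertex`).
[cite: MochizukiAbsTopIII2015, Cor 3.7 (ii) p.87] -/
def starDiagram : DiagramOfCategories.{u, u, 0} Cor37Vertex where
  obj := 𝔖.objAt
  cat := 𝔖.catAt
  map e := 𝔖.mapAt e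

/-- `𝒟†_{≤n}`, "the subdiagram of `𝒟†` determined by the first `n` rows" (`n = 4`: `𝒟†` itself), as
the full sub-diagram of `𝒟*` on the `𝒟†`-vertices of row `≤ n` (the `𝒟†`-edges are exactly the
`𝒟*`-edges among `𝒟†`-vertices, `Cor37Edge.inDagger_endpoints`).
[cite: MochizukiAbsTopIII2015, Cor 3.7 p.86] -/
def daggerLe (n : ℕ) :
    DiagramOfCategories.{u, u, 0} (SubVertex {a : Cor37Vertex | a.InDaggerLe n}) :=
  𝔖.starDiagram.restrict {a : Cor37Vertex | a.InDaggerLe n}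

/-- `𝒟*_{≤n}`: the full sub-diagram of `𝒟*` on rows `≤ n` (row 1 includes the core vertex; `n = 1`
gives `𝒟‡_δ`: the copies of `𝒳 ×_𝔈 𝒳`, the core `𝒳`, and the edges `log_𝒳`, `π_⋎`, `δ_⋎`).
[cite: MochizukiAbsTopIII2015, Cor 3.7 (ii) p.87] -/
def starLe (n : ℕ) : DiagramOfCategories.{u, u, 0} (SubVertex {a : Cor37Vertex | a.row ≤ n}) :=
  𝔖.starDiagram.restrict {a : Cor37Vertex | a.row ≤ n}

/-- A vertex of `𝒟†_{≤n}` from a vertex of `𝒟*` and a proof. [cite: MochizukiAbsTopIII2015, Cor 3.7 p.86] -/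
def dv (n : ℕ) (a : Cor37Vertex) (h : a.InDaggerLe n) :
    SubVertex {a : Cor37Vertex | a.InDaggerLe n} := ⟨a, h⟩

/-! ## Cor 3.7 (i): `𝔈` forms a core of `𝒟†`; the second factor `𝒳` forms a core of `𝒟‡_{≤1}` -/

/-- Observation-edge shape "`𝒟†_{≤4}` on `𝒟†_{≤3}`": the single edge `𝒩 → 𝔈` out of the `𝒩`-vertex.
[cite: MochizukiAbsTopIII2015, Cor 3.7 (i) p.87] -/
def galCoreI : SubVertex {a : Cor37Vertex | a.InDaggerLe 3} → Type u
  | ⟨.space, _⟩ => PUnit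
  | ⟨.first _, _⟩ => PEmpty
  | ⟨.box, _⟩ => PEmpty
  | ⟨.galois, _⟩ => PEmpty
  | ⟨.ref, _⟩ => PEmpty

/-- The shape `𝒟†_{≤3} ∪ {𝔈}` (no telecore edges). [cite: MochizukiAbsTopIII2015, Cor 3.7 (i) p.87] -/
def galCoreShape : ExtShape.{u} (SubVertex {a : Cor37Vertex | a.InDaggerLe 3}) where
  I := galCoreI.{u}
  J _ := PEmpty

/-- Extension data: `𝔈` at the observation vertex, `𝒩 → 𝔈` on the edge.
[cite: MochizukiAbsTopIII2015, Cor 3.7 (i) p.87] -/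
def galCoreExt : (𝔖.daggerLe 3).ExtData galCoreShape.{u} where
  S := E
  obsMap {a} i := match a, i with
    | ⟨.space, _⟩, _ => 𝔖.spaceGal
    | ⟨.first _, _⟩, i => PEmpty.elim i
    | ⟨.box, _⟩, i => PEmpty.elim i
    | ⟨.galois, _⟩, i => PEmpty.elim i
    | ⟨.ref, _⟩, i => PEmpty.elim i
  telMap j := PEmpty.elim j

/-- The observable `(𝒟†_{≤4}, v = 𝔈, ℋ)` on `𝒟†_{≤3}` determined by a family of homotopies `ℋ` whose
boundary paths end at `𝔈`. [cite: MochizukiAbsTopIII2015, Cor 3.7 (i) p.87] -/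
def galCoreObs (H : ((𝔖.daggerLe 3).extend 𝔖.galCoreExt).HomotopyFamily)
    (hH : ∀ ⦃a b : galCoreShape.{u}.Vertex⦄ ⦃p q : Path a b⦄, H.E p q → b = galCoreShape.{u}.obs) :
    (𝔖.daggerLe 3).Observable where
  shape := galCoreShape
  isEmpty_J _ := inferInstanceAs (IsEmpty PEmpty)
  ext := 𝔖.galCoreExt
  H := H
  terminal_obs := hH

/-- **Cor 3.7 (i), first half**: "`𝒟† = 𝒟†_{≤4}` admits a natural structure of core on `𝒟†_{≤3}`.
That is to say, loosely speaking, `𝔈` 'forms a core' of the functors in `𝒟†`": some family of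
homotopies makes the pinned observable `(𝒟†_{≤4}, 𝔈)` a core. Per-setting `Prop` (for the MLF
setting: "entirely similar to the proofs of Cor 3.6", p. 88 — the Galois group is undisturbed).
[cite: MochizukiAbsTopIII2015, Cor 3.7 (i) p.87] -/
def GaloisCoreStmt : Prop := ∃ H hH, (𝔖.galCoreObs H hH).IsCore

/-- Observation-edge shape "`𝒟‡_{≤1}` on `𝒟†_{≤1}`": one edge `π_⋎` out of each first-row vertex.
[cite: MochizukiAbsTopIII2015, Cor 3.7 (i) p.87] -/
def refCoreI : SubVertex {a : Cor37Vertex | a.InDaggerLe 1} → Type u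
  | ⟨.first _, _⟩ => PUnit
  | ⟨.box, _⟩ => PEmpty
  | ⟨.space, _⟩ => PEmpty
  | ⟨.galois, _⟩ => PEmpty
  | ⟨.ref, _⟩ => PEmpty

/-- The shape `𝒟†_{≤1} ∪ {𝒳}` with the projections `π_⋎` as observation edges (no telecore edges).
[cite: MochizukiAbsTopIII2015, Cor 3.7 (i) p.87] -/
def refCoreShape : ExtShape.{u} (SubVertex {a : Cor37Vertex | a.InDaggerLe 1}) where
  I := refCoreI.{u}
  J _ := PEmpty

/-- Extension data: the second factor `𝒳` at the new core vertex, `π_⋎` on the edges.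
[cite: MochizukiAbsTopIII2015, Cor 3.7 (i) p.87] -/
def refCoreExt : (𝔖.daggerLe 1).ExtData refCoreShape.{u} where
  S := X
  obsMap {a} i := match a, i with
    | ⟨.first _, _⟩, _ => 𝔖.proj
    | ⟨.box, _⟩, i => PEmpty.elim i
    | ⟨.space, _⟩, i => PEmpty.elim i
    | ⟨.galois, _⟩, i => PEmpty.elim i
    | ⟨.ref, _⟩, i => PEmpty.elim i
  telMap j := PEmpty.elim j

/-- The observable `(𝒟‡_{≤1}, v = 𝒳, ℋ)` on `𝒟†_{≤1}` determined by a family `ℋ` whose boundary paths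
end at the core vertex. [cite: MochizukiAbsTopIII2015, Cor 3.7 (i) p.87] -/
def refCoreObs (H : ((𝔖.daggerLe 1).extend 𝔖.refCoreExt).HomotopyFamily)
    (hH : ∀ ⦃a b : refCoreShape.{u}.Vertex⦄ ⦃p q : Path a b⦄, H.E p q → b = refCoreShape.{u}.obs) :
    (𝔖.daggerLe 1).Observable where
  shape := refCoreShape
  isEmpty_J _ := inferInstanceAs (IsEmpty PEmpty)
  ext := 𝔖.refCoreExt
  H := H
  terminal_obs := hH

/-- **Cor 3.7 (i), second half**: "`𝒟‡_{≤1}` admits a natural structure of core on `𝒟†_{≤1}` [...]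
the 'second factor' `𝒳` 'forms a core' of the functors in `𝒟‡_{≤1}`. [Thus, we think of the second
factor of the various fiber product categories `𝒳 ×_𝔈 𝒳` as being a 'universal reference model'.]"
Per-setting `Prop`; here every path functor into the core vertex EQUALS `π` on the nose
(`FiberSquare.baseChange_comp_π₂`), so the natural family consists of identities.
[cite: MochizukiAbsTopIII2015, Cor 3.7 (i) p.87] -/
def RefCoreStmt : Prop := ∃ H hH, (𝔖.refCoreObs H hH).IsCore

/-- **Cor 3.7 (i)** (both halves). [cite: MochizukiAbsTopIII2015, Cor 3.7 (i) p.87] -/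
def Cor_3_7_i : Prop := 𝔖.GaloisCoreStmt ∧ 𝔖.RefCoreStmt

/-! ## Cor 3.7 (v): total `□`-rigidity and the `ℤ`-action by nexus-classes of self-equivalences -/

/-- **Cor 3.7 (v)**, "Moreover, `𝒟*` is totally `□`-rigid" (Def 3.5 (vi): the pre-nexus portion
`𝒟*_{≤□}` — row 1, the core vertex and `□` — is vertex-rigid and edge-rigid). Per-setting `Prop`
(for the MLF setting it rests on Prop 3.2 (iv), as for Cor 3.6 (v)).
[cite: MochizukiAbsTopIII2015, Cor 3.7 (v) p.88] -/
def TotallyBoxRigidStmt : Prop :=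
  𝔖.starDiagram.IsTotallyNexusRigid Cor37Vertex.box {a : Cor37Vertex | a.BelowBox}

/-- **Cor 3.7 (v)**, "the natural action of `ℤ` on the infinite linear oriented graph `Γ⃗_{𝒟†_{≤1}}`
extends to an action of `ℤ` on `𝒟*` by nexus-classes of self-equivalences of `𝒟*`": for every `m : ℤ`
a nexus self-equivalence (Def 3.5 (vi), t2's `IsNexusClass`) of `𝒟*` whose underlying morphism of
graphs IS the translation `Cor37Vertex.shift m`, with `Φ_0 ≅ id` and `Φ_m ∘ Φ_{m'} ≅ Φ_{m+m'}` up to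
2-isomorphism (an action by isomorphism CLASSES; same shape as abc-iut-L4-t5's Cor 3.6 (v)
`ShiftStmt`). NOT typed: the closing compatibility sentence of (v) (module docstring).
[cite: MochizukiAbsTopIII2015, Cor 3.7 (v) p.88] -/
def ShiftStmt : Prop :=
  ∃ Φ : ℤ → 𝔖.starDiagram.SelfEquivalence,
    (∀ m, (Φ m).graphMap = Cor37Vertex.shift m) ∧
    (∀ m, (Φ m).IsNexusClass Cor37Vertex.box {a : Cor37Vertex | a.BelowBox}) ∧
    (∃ h₀ : (Φ 0).graphMap = 𝟭q Cor37Vertex,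
      (h₀ ▸ (Φ 0).hom).Isomorphic (OneMorphism.id 𝔖.starDiagram)) ∧
    (∀ m m' : ℤ, ∃ h : (Φ m).graphMap ⋙q (Φ m').graphMap = (Φ (m + m')).graphMap,
      (h ▸ ((Φ m).hom.comp (Φ m').hom)).Isomorphic (Φ (m + m')).hom)

/-- **Cor 3.7 (v)**, the typed part assembled: `□` is a nexus (PROVED, `Cor37Vertex.box_isNexus`),
`𝒟*` is totally `□`-rigid, and `ℤ` acts by nexus-classes of self-equivalences.
[cite: MochizukiAbsTopIII2015, Cor 3.7 (v) p.88] -/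
def Cor_3_7_v : Prop :=
  IsNexus.{u, 0} (Cor37Vertex.box : Cor37Vertex) {a : Cor37Vertex | a.BelowBox} ∧
    𝔖.TotallyBoxRigidStmt ∧ 𝔖.ShiftStmt

/-- The nexus conjunct of `Cor_3_7_v` is discharged. [cite: MochizukiAbsTopIII2015, Cor 3.7 (v) p.88] -/
theorem cor_3_7_v_iff : 𝔖.Cor_3_7_v ↔ 𝔖.TotallyBoxRigidStmt ∧ 𝔖.ShiftStmt :=
  ⟨fun h => h.2, fun h => ⟨Cor37Vertex.box_isNexus, h⟩⟩

end BiAnabelianSetting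

end Literature.AnabelianGeometry.AbsoluteAnabelian.AbsTopIII
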